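import Literature.NumberTheory.EllipticCurves.HeckeGrossencharakterFunctionalEquation
import Literature.NumberTheory.GaloisRepresentations.HeckeCharacterWeakApproximation
import Literature.NumberTheory.GaloisRepresentations.HeckeCharacterRamificationProofs
import Literature.NumberTheory.GaloisRepresentations.HeckeCharacterOfGrossencharakter
import HarnessLib

/-!
# The complex-conjugate Hecke character `χ̄` and a Frobenius criterion for conj-equivariance

Topic `Literature/NumberTheory/EllipticCurves` (companion of `RohrlichAnticyclotomicNonvanishing.lean`, which
defines `IsHeckeConjEquivariant c φ : ∀ x, φ(c • x) = \overline{φ(x)}`, and of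
`HeckeGrossencharakterFunctionalEquation.lean`, whose `heckeLFunctionConj` is the `L`-function of `χ̄` "avoiding a
`χ̄` as a `HeckeCharacter`"). Cell `pub/bsd-wall`, width seat `bsd-wall-cm-bed-w3` g15 (BED, Deuring-Grössencharacter lane:
clause (ii) of `Deuring_exists_heckeCharacter_of_maximalCM` is `IsHeckeConjEquivariant c ψ`, and the idelic characters the tree
CONSTRUCTS — `heckeOfGross`, `exists_heckeCharacter_quarticTwist`, `exists_heckeCharacter_primaryGen` — are known only through
their values at uniformisers off the modulus; this file turns that knowledge into equivariance).

* `HeckeCharacter.conjugate χ = χ̄` (`x ↦ \overline{χ(x)}`): a Hecke character (continuous, trivial on `Kˣ`); pointwise,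
  local components, `χ̄` unramified iff `χ` is, `χ̄(ϖ_v) = \overline{χ(ϖ_v)}`, involutive, multiplicative; infinity type
  `(q, p)` if `χ` has type `(p, q)` (`\overline{A_{p,q}} = A_{q,p}`); `L(χ̄, s) = heckeLFunctionConj χ s`.
* `isHeckeConjEquivariant_iff_galConj_eq_conjugate`: `φ` is conj-equivariant iff `φ ∘ c = φ̄` as Hecke characters.
* ★ `IsHeckeConjEquivariant.of_eventually_valueAtUniformizer_eq`: **if `φ(ϖ_{c•v}) = \overline{φ(ϖ_v)}` for all but
  finitely many finite places `v`, then `φ` is conj-equivariant** — two Hecke characters agreeing at almost all uniformisers are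
  equal (`HeckeCharacter.ext_of_eventually_valueAtUniformizer_eq`, weak approximation), applied to `φ ∘ c` and `φ̄`
  (`(φ∘c)(ϖ_v) = φ(ϖ_{c v})` at the cofinitely many `v` with `φ` unramified at `c • v`, Tate's Lemma 3.2.1
  `finite_ramifiedPlaces_holds`); and the `iff` form `isHeckeConjEquivariant_iff_eventually`.
* `isHeckeConjEquivariant_heckeOfGross`: for a Grössencharakter `ψ mod 𝔣` with `ψ(c • 𝔭) = \overline{ψ(𝔭)}` whenever
  `𝔭, c • 𝔭 ∤ 𝔣`, the Hecke character `heckeOfGross` it induces is conj-equivariant (Jia 2026 §1: "equivariant: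
  `χ(𝔞̄) = \overline{χ(𝔞)}`"; for the Grössencharacter of a CM elliptic curve over `ℚ` this is Silverman *ATAEC* II
  Ex. 2.30 (b)–(c) with Cor. 10.4.1 (c): `ψ(𝔓″) = \overline{ψ(𝔓′)}`, `ψ(𝔓′) = −q` real at inert primes).

Everything is proved; the only definition is `HeckeCharacter.conjugate` (with body). No instance, no notation.

## References
* [Jia2026ActaArith] J. Jia, Acta Arith. (2026), §1 (equivariant Hecke characters `χ(𝔞̄) = \overline{χ(𝔞)}`).
* [SilvermanATAEC1994] J. H. Silverman, *Advanced Topics*, GTM 151, Ch. II Ex. 2.30, Cor. 10.4.1 (c) (p. 171, 179).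
* [TateThesis1967] J. Tate, in Cassels–Fröhlich (1967), Ch. XV, Lemma 3.2.1 (almost everywhere unramified), §4.3.
* [NeukirchANT1999] J. Neukirch, *Algebraic Number Theory*, Ch. VII §6 Cor. (6.14) (Hecke characters vs Größencharaktere).
-/

noncomputable section

open scoped ComplexConjugate
open NumberField IsDedekindDomain Filter

namespace Literature.NumberTheory.GaloisRepresentations

namespace HeckeCharacter

variable {K : Type*} [Field K] [NumberField K]

/-! ## §1. The complex-conjugate character `χ̄` -/

/-- **The complex-conjugate Hecke character `χ̄ : x ↦ \overline{χ(x)}`** (continuous since complex conjugation is;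
trivial on principal ideles since `χ` is). Jia 2026 §1 writes `χ̄`; de Shalit II.1.1 (3) the character on the dual side
of Hecke's functional equation. [cite: Jia2026ActaArith, §1] -/
def conjugate (χ : HeckeCharacter K) : HeckeCharacter K where
  toContinuousMonoidHom :=
    { toMonoidHom := (Units.map ((starRingEnd ℂ : ℂ →+* ℂ) : ℂ →* ℂ)).comp χ.toContinuousMonoidHom.toMonoidHom
      continuous_toFun :=
        (Continuous.units_map ((starRingEnd ℂ : ℂ →+* ℂ) : ℂ →* ℂ) Complex.continuous_conj).comp
          (map_continuous χ) }
  map_principal' x hx := by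
    change Units.map ((starRingEnd ℂ : ℂ →+* ℂ) : ℂ →* ℂ) (χ x) = 1
    rw [χ.map_principal hx, map_one]

/-- `χ̄(x) = \overline{χ(x)}` in `ℂˣ`. [cite: Jia2026ActaArith, §1 (the character χ̄)] -/
theorem conjugate_apply (χ : HeckeCharacter K) (x : ideleGroup K) :
    χ.conjugate x = Units.map ((starRingEnd ℂ : ℂ →+* ℂ) : ℂ →* ℂ) (χ x) := rfl

/-- `χ̄(x) = \overline{χ(x)}` in `ℂ`. [cite: Jia2026ActaArith, §1 (the character χ̄)] -/
@[simp] theorem coe_conjugate_apply (χ : HeckeCharacter K) (x : ideleGroup K) :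
    ((χ.conjugate x : ℂˣ) : ℂ) = conj ((χ x : ℂˣ) : ℂ) := rfl

/-- Local components of `χ̄`: `χ̄_v = \overline{χ_v}`. [cite: TateThesis1967, §2.3 (local quasi-characters)] -/
theorem coe_localComponent_conjugate (χ : HeckeCharacter K) (v : HeightOneSpectrum (𝓞 K))
    (u : (v.adicCompletion K)ˣ) :
    ((χ.conjugate.localComponent v u : ℂˣ) : ℂ) = conj ((χ.localComponent v u : ℂˣ) : ℂ) := rfl

/-- `χ̄` is unramified at `v` iff `χ` is (`\overline{z} = 1 ↔ z = 1`); de Shalit II.1.1: `χ̄` has the same conductor as `χ`.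
[cite: deShalit1987, II.1.1 (3)] -/
theorem isUnramifiedAt_conjugate_iff (χ : HeckeCharacter K) (v : HeightOneSpectrum (𝓞 K)) :
    χ.conjugate.IsUnramifiedAt v ↔ χ.IsUnramifiedAt v := by
  refine forall_congr' fun u => ?_
  rw [← Units.val_eq_one, coe_localComponent_conjugate, map_eq_one_iff (starRingEnd ℂ) (RingHom.injective _),
    Units.val_eq_one]

/-- `χ̄(ϖ_v) = \overline{χ(ϖ_v)}` (Jia 2026 §1: `χ̄(𝔞) = \overline{χ(𝔞)}`). [cite: Jia2026ActaArith, §1 (the character χ̄)] -/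
@[simp] theorem valueAtUniformizer_conjugate (χ : HeckeCharacter K) (v : HeightOneSpectrum (𝓞 K)) :
    χ.conjugate.valueAtUniformizer v = conj (χ.valueAtUniformizer v) := rfl

/-- `χ̄̄ = χ` (complex conjugation is an involution). [cite: Jia2026ActaArith, §1 (the character χ̄)] -/
@[simp] theorem conjugate_conjugate (χ : HeckeCharacter K) : χ.conjugate.conjugate = χ := by
  ext x
  rw [coe_conjugate_apply, coe_conjugate_apply, Complex.conj_conj]

/-- `\overline{χ ψ} = χ̄ ψ̄` (conjugation is an automorphism of the group of Hecke characters, Neukirch VII (6.11)).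
[cite: NeukirchANT1999, Ch. VII §6 Def. (6.11)] -/
theorem conjugate_mul (χ ψ : HeckeCharacter K) : (χ * ψ).conjugate = χ.conjugate * ψ.conjugate := by
  ext x
  simp only [coe_conjugate_apply, mul_apply, Units.val_mul, map_mul]

/-- `1̄ = 1`. [cite: NeukirchANT1999, Ch. VII §6 Def. (6.11)] -/
@[simp] theorem conjugate_one : (1 : HeckeCharacter K).conjugate = 1 := by
  ext x
  simp only [coe_conjugate_apply, one_apply, Units.val_one, map_one]

/-- `\overline{χ⁻¹} = χ̄⁻¹`. [cite: NeukirchANT1999, Ch. VII §6 Def. (6.11)] -/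
theorem conjugate_inv (χ : HeckeCharacter K) : χ⁻¹.conjugate = χ.conjugate⁻¹ := by
  ext x
  simp only [coe_conjugate_apply, inv_apply, Units.val_inv_eq_inv_val, map_inv₀]

/-- `\overline{A_{p,q}(x)} = A_{q,p}(x)` for the archimedean factor `A_{p,q}(x) = ∏_w ι_w(x_w)^{-p_w} \overline{ι_w(x_w)}^{-q_w}`.
[cite: Weil1956, §1] -/
theorem conj_archFactor (p q : InfinitePlace K → ℤ) (x : (InfiniteAdeleRing K)ˣ) :
    conj (archFactor p q x) = archFactor q p x := by
  simp only [archFactor, MonoidHom.coe_mk, OneHom.coe_mk, map_prod, map_mul, map_zpow₀, Complex.conj_conj]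
  exact Finset.prod_congr rfl fun w _ => mul_comm _ _

/-- **`χ̄` has infinity type `(q, p)` if `χ` has infinity type `(p, q)`.** [cite: Weil1956, §1] -/
theorem HasInfinityType.conjugate {χ : HeckeCharacter K} {p q : InfinitePlace K → ℤ} (h : χ.HasInfinityType p q) :
    χ.conjugate.HasInfinityType q p := by
  obtain ⟨U, hU, hχU⟩ := h
  refine ⟨U, hU, fun x hx => ?_⟩
  rw [coe_conjugate_apply, hχU x hx, conj_archFactor]

/-- `χ̄` is algebraic if `χ` is. [cite: Weil1956, §1] -/
theorem IsAlgebraic.conjugate {χ : HeckeCharacter K} (h : χ.IsAlgebraic) : χ.conjugate.IsAlgebraic := by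
  obtain ⟨p, q, hpq⟩ := h
  exact ⟨q, p, HasInfinityType.conjugate hpq⟩

/-- `χ̄` is unitary iff `χ` is (`|\overline{z}| = |z|`); for unitary `χ`, `χ̄ = χ⁻¹` (Tate §4.4). [cite: TateThesis1967, §4.4] -/
theorem isUnitary_conjugate_iff (χ : HeckeCharacter K) : χ.conjugate.IsUnitary ↔ χ.IsUnitary := by
  refine forall_congr' fun x => ?_
  rw [coe_conjugate_apply, Complex.norm_conj]

end HeckeCharacter

/-- **`L(χ̄, s)` is the tree's `heckeLFunctionConj χ s`** (`= \overline{L(χ, s̄)}`, `heckeLFunctionConj_eq_conj`): the two Euler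
products run over the same unramified places with the same factors. [cite: deShalit1987, II.1.1 (3) (shape only)] -/
theorem heckeLFunction_conjugate {K : Type} [Field K] [NumberField K] (χ : HeckeCharacter K) (s : ℂ) :
    heckeLFunction χ.conjugate s = Literature.NumberTheory.EllipticCurves.heckeLFunctionConj χ s := by
  unfold heckeLFunction Literature.NumberTheory.EllipticCurves.heckeLFunctionConj
  let e : {v : HeightOneSpectrum (𝓞 K) // χ.conjugate.IsUnramifiedAt v} ≃
      {w : HeightOneSpectrum (𝓞 K) // χ.IsUnramifiedAt w} :=
    Equiv.subtypeEquivRight fun v => χ.isUnramifiedAt_conjugate_iff v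
  have hre := Equiv.tprod_eq e (fun w : {w : HeightOneSpectrum (𝓞 K) // χ.IsUnramifiedAt w} =>
    (1 - conj (χ.valueAtUniformizer w.1) * ((w.1.residueCard : ℂ) ^ (-s)))⁻¹)
  rw [← hre]
  exact tprod_congr fun v => rfl

end Literature.NumberTheory.GaloisRepresentations

namespace Literature.NumberTheory.EllipticCurves

open Literature.NumberTheory.Automorphic Literature.NumberTheory.GaloisRepresentations

variable {K : Type} [Field K] [NumberField K] {c : K ≃ₐ[ℚ] K} {χ : HeckeCharacter K}

/-! ## §2. Conj-equivariance as an identity of Hecke characters, and the Frobenius criterion -/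

/-- `φ` is conj-equivariant iff `φ ∘ c = φ̄` as Hecke characters. [cite: Jia2026ActaArith, §1] -/
theorem isHeckeConjEquivariant_iff_galConj_eq_conjugate :
    IsHeckeConjEquivariant c χ ↔ HeckeCharacter.galConj c χ = χ.conjugate := by
  constructor
  · intro h
    ext x
    exact h x
  · intro h x
    rw [h, HeckeCharacter.coe_conjugate_apply]

/-- `χ` is unramified at `c • v` for all but finitely many `v` (Tate's Lemma 3.2.1 and injectivity of `v ↦ c • v`).
[cite: TateThesis1967, Lemma 3.2.1] -/
theorem eventually_isUnramifiedAt_smul (c : K ≃ₐ[ℚ] K) (χ : HeckeCharacter K) :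
    ∀ᶠ v in cofinite, χ.IsUnramifiedAt (c • v) := by
  have h0 : ∀ᶠ v in cofinite, χ.IsUnramifiedAt v :=
    (χ.finite_ramifiedPlaces_iff).mp (HeckeCharacter.finite_ramifiedPlaces_holds χ)
  exact ((MulAction.injective c).tendsto_cofinite).eventually h0

/-- ★ **Frobenius criterion for conj-equivariance.** If `φ(ϖ_{c•v}) = \overline{φ(ϖ_v)}` for all but finitely many finite
places `v` of `K`, then `φ(c • x) = \overline{φ(x)}` for EVERY idele `x`: the Hecke characters `φ ∘ c` and `φ̄` agree at almost
all uniformisers (`(φ∘c)(ϖ_v) = φ(ϖ_{cv})` wherever `φ` is unramified at `c • v`), hence are equal by weak approximation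
(`HeckeCharacter.ext_of_eventually_valueAtUniformizer_eq`). [cite: Jia2026ActaArith, §1] [cite: NeukirchANT1999, Ch. VII §6 Cor. (6.14)] -/
theorem IsHeckeConjEquivariant.of_eventually_valueAtUniformizer_eq
    (h : ∀ᶠ v in cofinite, χ.valueAtUniformizer (c • v) = conj (χ.valueAtUniformizer v)) :
    IsHeckeConjEquivariant c χ := by
  rw [isHeckeConjEquivariant_iff_galConj_eq_conjugate]
  refine HeckeCharacter.ext_of_eventually_valueAtUniformizer_eq ?_
  filter_upwards [h, eventually_isUnramifiedAt_smul c χ] with v hv hu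
  rw [HeckeCharacter.valueAtUniformizer_galConj_of_isUnramifiedAt c χ v hu, hv,
    HeckeCharacter.valueAtUniformizer_conjugate]

/-- **Conj-equivariance ⟺ `φ(ϖ_{c•v}) = \overline{φ(ϖ_v)}` for almost all `v`.** [cite: Jia2026ActaArith, §1] -/
theorem isHeckeConjEquivariant_iff_eventually :
    IsHeckeConjEquivariant c χ ↔ ∀ᶠ v in cofinite, χ.valueAtUniformizer (c • v) = conj (χ.valueAtUniformizer v) := by
  refine ⟨fun h => ?_, IsHeckeConjEquivariant.of_eventually_valueAtUniformizer_eq⟩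
  filter_upwards [eventually_isUnramifiedAt_smul c χ] with v hu
  rw [← HeckeCharacter.valueAtUniformizer_galConj_of_isUnramifiedAt c χ v hu, h.valueAtUniformizer_galConj']

/-- For conj-equivariant `φ`: `φ̄ = φ ∘ c` is conj-equivariant as well. [cite: Jia2026ActaArith, §1] -/
theorem IsHeckeConjEquivariant.conjugate (h : IsHeckeConjEquivariant c χ) : IsHeckeConjEquivariant c χ.conjugate := by
  intro x
  rw [HeckeCharacter.galConj_apply, HeckeCharacter.coe_conjugate_apply, HeckeCharacter.coe_conjugate_apply,
    ← HeckeCharacter.galConj_apply, h x]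

/-- For conj-equivariant `φ`: `L(φ̄, s) = L(φ, s)`. [cite: Jia2026ActaArith, §1 ("L(s,χ) = … = L(s, χ̄)")] -/
theorem IsHeckeConjEquivariant.heckeLFunction_conjugate_eq (h : IsHeckeConjEquivariant c χ) (s : ℂ) :
    heckeLFunction χ.conjugate s = heckeLFunction χ s := by
  rw [heckeLFunction_conjugate, h.heckeLFunctionConj_eq]

/-! ## §3. Größencharaktere with conj-equivariant values induce conj-equivariant Hecke characters -/

/-- The primes dividing a nonzero ideal, and their `c`-translates, are finitely many: for all but finitely many `v`, both
`v ∤ 𝔣` and `c • v ∤ 𝔣`. [folklore] -/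
private theorem eventually_not_le_and_not_le_smul (c : K ≃ₐ[ℚ] K) {𝔣 : Ideal (𝓞 K)} (h𝔣 : 𝔣 ≠ ⊥) :
    ∀ᶠ v : HeightOneSpectrum (𝓞 K) in cofinite, ¬ 𝔣 ≤ v.asIdeal ∧ ¬ 𝔣 ≤ (c • v).asIdeal := by
  have hfin : ∀ᶠ v : HeightOneSpectrum (𝓞 K) in cofinite, ¬ 𝔣 ≤ v.asIdeal := by
    refine (Ideal.finite_factors h𝔣).subset fun v hv => ?_
    simp only [Set.mem_compl_iff, Set.mem_setOf_eq, not_not] at hv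
    exact Ideal.dvd_iff_le.mpr hv
  exact hfin.and (((MulAction.injective c).tendsto_cofinite).eventually hfin)

/-- **A Größencharakter `mod 𝔣` with `ψ(c • 𝔭) = \overline{ψ(𝔭)}` (for `𝔭, c • 𝔭 ∤ 𝔣`) induces a conj-equivariant Hecke
character** (`heckeOfGross`: `ω(ϖ_𝔭) = ψ(𝔭)` off `𝔣`, so the Frobenius criterion applies). For the Grössencharacter of a CM elliptic
curve over `ℚ` the hypothesis is Silverman *ATAEC* II Ex. 2.30 (b)–(c) with Cor. 10.4.1 (c) (`ψ(𝔓″) = \overline{ψ(𝔓′)}` at split,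
`ψ(𝔓′) = −q ∈ ℝ` at inert good primes). [cite: Jia2026ActaArith, §1] [cite: SilvermanATAEC1994, Ch. II Ex. 2.30 (b), (c) and Cor. 10.4.1 (c) (p. 171, 179)] -/
theorem isHeckeConjEquivariant_heckeOfGross (c : K ≃ₐ[ℚ] K) {𝔣 : Ideal (𝓞 K)} (h𝔣 : 𝔣 ≠ ⊥)
    {p q : InfinitePlace K → ℤ} {ψ : HeightOneSpectrum (𝓞 K) → ℂ} (hψ : IsGrossencharakter 𝔣 p q ψ)
    (hc : ∀ v : HeightOneSpectrum (𝓞 K), ¬ 𝔣 ≤ v.asIdeal → ¬ 𝔣 ≤ (c • v).asIdeal → ψ (c • v) = conj (ψ v)) :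
    IsHeckeConjEquivariant c (heckeOfGross h𝔣 hψ) := by
  refine IsHeckeConjEquivariant.of_eventually_valueAtUniformizer_eq ?_
  filter_upwards [eventually_not_le_and_not_le_smul c h𝔣] with v hv
  rw [heckeOfGross_valueAtUniformizer h𝔣 hψ hv.2, heckeOfGross_valueAtUniformizer h𝔣 hψ hv.1, hc v hv.1 hv.2]

end Literature.NumberTheory.EllipticCurves

end
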